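import Summits.QuantumFields.YangMills.Theorems.LuscherReductionTwistedTraceScalingPolarMean
import HarnessLib

/-!
# COVERAGE of the near-vacuum region by the orthographic constant-mode tube: links within `δ ≤ 1/50` of `1` (in scalar part) lie in the tube, with
# slow variable the polar mean and transverse coordinate of size `|v_e|² ≤ 10δ`
# (lane A of S-BASE, crux `TwistedTraceScaling` stmt-QuantumFields-20203, sub-target C4 INNER; design note `pub/ym-fleet/ym-luscher-20007-p1/COARSE-DESIGN.md` §23)

If every link of `U` has scalar part `(U_e)₀ ≥ 1 − δ` with `0 ≤ δ ≤ 1/50` then, for every direction `k` (with `S_k, V⃗_k, M_k, p_k` of `…PolarMean`):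
* `N(1−δ) ≤ S_k ≤ N`, `|V⃗_k|² ≤ 2δ N²`, `‖M_k‖² ≤ N²(1+2δ)` (`N = L³` sites; Cauchy–Schwarz), so `M_k ≠ 0`;
* ★ `scalarPart_rel_mul_norm_ge`: `(U_e p_k⁻¹)₀ · ‖M_k‖ = (U_e)₀ S_k + U⃗_e·V⃗_k ≥ N(1 − 4δ + δ²) > 0`;
* ★★ `sum_vecPart_rel_sq_le`: the transverse coordinate is small, `|(U_e p_k⁻¹)⃗|² ≤ 10δ` (`≤ 1/4`), and `(U_e p_k⁻¹)₀ ≥ 0`;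
* ★★★ `mem_orthoTubeSet_of_near_one`: `U = orthoTube L (slowMean L U) v` with `v_e = (U_e p_{dir e}⁻¹)⃗ ∈ capBalancedSet L` (balance is AUTOMATIC,
  `sum_vecPart_mul_polarMean_inv_apply`), hence `U ∈ orthoTubeSet L`, with `|v_e|² ≤ 10δ` for every link.
With the equivariance `orthoTube_mul` the same holds near any constant configuration, and after a gauge transformation near any point of the vacuum orbit:
this is the coverage input (`hψcov`, `hN`) of the gauge-slice identity `…GaugeSlice.slice_package` for test functions supported in `{orbitDist < δ'}`.
HONEST FRAMING: elementary estimates for a stub of a child of the CONDITIONAL reduction route R2b1; no kernel estimate; C4 OPEN; not a gap, not Clay.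
-/

set_option autoImplicit false

noncomputable section

open MeasureTheory Filter Topology Real
open scoped BigOperators Matrix
open Literature.MathematicalPhysics.QuantumFieldTheory
open Literature.MathematicalPhysics.QuantumLattice

namespace Summit.QuantumFields.YangMills.Theorems.FemtoTransferGap.TwoLattice.ConstTube

open Summit.QuantumFields.YangMills.Theorems.FemtoTransferGap

variable (L : ℕ) [NeZero L]

/-! ## §1 Sizes of the direction sums near the vacuum -/

/-- The scalar part is at most `1`. [folklore] -/
theorem scalarPart_le_one (W : SU2) : scalarPart W ≤ 1 := (le_abs_self _).trans (abs_scalarPart_le W)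

/-- Near the vacuum the vector part is small: `(W)₀ ≥ 1 − δ`, `δ ≥ 0` ⇒ `|W⃗|² ≤ 2δ`. [folklore] -/
theorem sum_vecPart_sq_le_of_near {W : SU2} {δ : ℝ} (hδ : 0 ≤ δ) (hW : 1 - δ ≤ scalarPart W) : ∑ a, vecPart W a ^ 2 ≤ 2 * δ := by
  rw [sum_vecPart_sq]
  have h1 := scalarPart_le_one W
  nlinarith

section Near

variable {L}

/-- `N(1−δ) ≤ S_k`. [folklore] -/
theorem dirScalarSum_ge {U : GaugeConfig 3 L SU2} {δ : ℝ} (hU : ∀ e : Edge 3 L, 1 - δ ≤ scalarPart (U e)) (k : Fin 3) : (Fintype.card (Site 3 L) : ℝ) * (1 - δ) ≤ dirScalarSum L k U := by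
  unfold dirScalarSum
  calc (Fintype.card (Site 3 L) : ℝ) * (1 - δ) = ∑ _x : Site 3 L, (1 - δ) := by rw [Finset.sum_const, Finset.card_univ, nsmul_eq_mul]
    _ ≤ ∑ x : Site 3 L, scalarPart (U (x, k)) := Finset.sum_le_sum fun x _ => hU (x, k)

/-- `S_k ≤ N`. [folklore] -/
theorem dirScalarSum_le (k : Fin 3) (U : GaugeConfig 3 L SU2) : dirScalarSum L k U ≤ Fintype.card (Site 3 L) := by
  unfold dirScalarSum
  calc ∑ x : Site 3 L, scalarPart (U (x, k)) ≤ ∑ _x : Site 3 L, (1 : ℝ) := Finset.sum_le_sum fun x _ => scalarPart_le_one _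
    _ = Fintype.card (Site 3 L) := by rw [Finset.sum_const, Finset.card_univ, nsmul_eq_mul, mul_one]

/-- `−N ≤ S_k`. [folklore] -/
theorem neg_le_dirScalarSum (k : Fin 3) (U : GaugeConfig 3 L SU2) : -(Fintype.card (Site 3 L) : ℝ) ≤ dirScalarSum L k U := by
  unfold dirScalarSum
  calc -(Fintype.card (Site 3 L) : ℝ) = ∑ _x : Site 3 L, (-1 : ℝ) := by rw [Finset.sum_const, Finset.card_univ, nsmul_eq_mul, mul_neg, mul_one]
    _ ≤ ∑ x : Site 3 L, scalarPart (U (x, k)) := Finset.sum_le_sum fun x _ => (abs_le.mp (abs_scalarPart_le (U (x, k)))).1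

/-- `|V⃗_k|² ≤ 2δ N²` (Cauchy–Schwarz). [folklore] -/
theorem sum_dirVecSum_sq_le {U : GaugeConfig 3 L SU2} {δ : ℝ} (hδ : 0 ≤ δ) (hU : ∀ e : Edge 3 L, 1 - δ ≤ scalarPart (U e)) (k : Fin 3) : ∑ a, dirVecSum L k U a ^ 2 ≤ 2 * δ * (Fintype.card (Site 3 L) : ℝ) ^ 2 := by
  have hcs : ∀ a : Fin 3, dirVecSum L k U a ^ 2 ≤ Fintype.card (Site 3 L) * ∑ x : Site 3 L, vecPart (U (x, k)) a ^ 2 := fun a => by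
    unfold dirVecSum
    rw [Finset.sum_apply]
    have h := sq_sum_le_card_mul_sum_sq (s := (Finset.univ : Finset (Site 3 L))) (f := fun x => vecPart (U (x, k)) a)
    rwa [Finset.card_univ] at h
  calc ∑ a, dirVecSum L k U a ^ 2 ≤ ∑ a, (Fintype.card (Site 3 L) * ∑ x : Site 3 L, vecPart (U (x, k)) a ^ 2) := Finset.sum_le_sum fun a _ => hcs a
    _ = Fintype.card (Site 3 L) * ∑ x : Site 3 L, ∑ a, vecPart (U (x, k)) a ^ 2 := by rw [← Finset.mul_sum, Finset.sum_comm]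
    _ ≤ Fintype.card (Site 3 L) * ∑ _x : Site 3 L, 2 * δ := by
        gcongr with x
        exact sum_vecPart_sq_le_of_near hδ (hU (x, k))
    _ = 2 * δ * (Fintype.card (Site 3 L) : ℝ) ^ 2 := by rw [Finset.sum_const, Finset.card_univ, nsmul_eq_mul]; ring

/-- `‖M_k‖² ≤ N²(1 + 2δ)`. [folklore] -/
theorem norm_dirQuat_sq_le {U : GaugeConfig 3 L SU2} {δ : ℝ} (hδ : 0 ≤ δ) (hU : ∀ e : Edge 3 L, 1 - δ ≤ scalarPart (U e)) (k : Fin 3) :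
    ‖dirQuat L k U‖ ^ 2 ≤ (Fintype.card (Site 3 L) : ℝ) ^ 2 * (1 + 2 * δ) := by
  rw [sq, ← Quaternion.normSq_eq_norm_mul_self, normSq_dirQuat]
  have h1 := dirScalarSum_le k U
  have h2 := neg_le_dirScalarSum k U
  have h3 := sum_dirVecSum_sq_le hδ hU k
  have hS : dirScalarSum L k U ^ 2 ≤ (Fintype.card (Site 3 L) : ℝ) ^ 2 := sq_le_sq' h2 h1
  nlinarith

/-- For `δ < 1` the direction sums do not vanish. [folklore] -/
theorem dirQuat_ne_zero_of_near {U : GaugeConfig 3 L SU2} {δ : ℝ} (hU : ∀ e : Edge 3 L, 1 - δ ≤ scalarPart (U e)) (hδ1 : δ < 1) (k : Fin 3) :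
    dirQuat L k U ≠ 0 := by
  refine dirQuat_ne_zero_of_scalarSum_pos L (lt_of_lt_of_le ?_ (dirScalarSum_ge hU k))
  have hN : (0 : ℝ) < Fintype.card (Site 3 L) := by exact_mod_cast Fintype.card_pos
  exact mul_pos hN (by linarith)

/-! ## §2 The relative links `U_e p_k⁻¹` lie in the cap, with small vector part -/

/-- ★ **The relative scalar part times `‖M_k‖` is large**: `(U_{(x,k)} p_k⁻¹)₀ · ‖M_k‖ = (U_x)₀ S_k + U⃗_x · V⃗_k ≥ N(1 − 4δ + δ²)`. [folklore] -/
theorem scalarPart_rel_mul_norm_ge {U : GaugeConfig 3 L SU2} {δ : ℝ} (hδ : 0 ≤ δ) (hU : ∀ e : Edge 3 L, 1 - δ ≤ scalarPart (U e)) (hδ1 : δ < 1)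
    (x : Site 3 L) (k : Fin 3) :
    (Fintype.card (Site 3 L) : ℝ) * (1 - 4 * δ + δ ^ 2) ≤ scalarPart (U (x, k) * (polarMean L k U)⁻¹) * ‖dirQuat L k U‖ := by
  have hM := dirQuat_ne_zero_of_near hU hδ1 k
  have hn0 : ‖dirQuat L k U‖ ≠ 0 := norm_ne_zero_iff.mpr hM
  obtain ⟨hs, hv⟩ := parts_polarMean L hM
  -- the exact expression
  have hexp : scalarPart (U (x, k) * (polarMean L k U)⁻¹) * ‖dirQuat L k U‖ =
      scalarPart (U (x, k)) * dirScalarSum L k U + vecPart (U (x, k)) ⬝ᵥ dirVecSum L k U := by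
    rw [scalarPart_mul_inv, hs, hv, dotProduct_smul, smul_eq_mul]
    field_simp
  rw [hexp]
  -- Cauchy–Schwarz for the vector term: `(U⃗_x · V⃗)² ≤ |U⃗_x|² |V⃗|² ≤ (2δ)(2δN²)`
  set N : ℝ := (Fintype.card (Site 3 L) : ℝ) with hN_def
  have hN : (0 : ℝ) ≤ N := Nat.cast_nonneg _
  have hcs : (vecPart (U (x, k)) ⬝ᵥ dirVecSum L k U) ^ 2 ≤ (2 * δ) * (2 * δ * N ^ 2) := by
    calc (vecPart (U (x, k)) ⬝ᵥ dirVecSum L k U) ^ 2 ≤ (∑ a, vecPart (U (x, k)) a ^ 2) * ∑ a, dirVecSum L k U a ^ 2 :=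
          Finset.sum_mul_sq_le_sq_mul_sq _ _ _
      _ ≤ (2 * δ) * (2 * δ * N ^ 2) :=
          mul_le_mul (sum_vecPart_sq_le_of_near hδ (hU (x, k))) (sum_dirVecSum_sq_le hδ hU k) (Finset.sum_nonneg fun a _ => sq_nonneg _) (by positivity)
  have habs : -(2 * δ * N) ≤ vecPart (U (x, k)) ⬝ᵥ dirVecSum L k U := by
    have hsq : (vecPart (U (x, k)) ⬝ᵥ dirVecSum L k U) ^ 2 ≤ (2 * δ * N) ^ 2 := by nlinarith [hcs]
    exact (abs_le_of_sq_le_sq' hsq (by positivity)).1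
  have hS := dirScalarSum_ge hU k
  have hsx := hU (x, k)
  have hS0 : 0 ≤ dirScalarSum L k U := by nlinarith
  nlinarith [mul_le_mul hsx hS (by nlinarith) (by linarith)]

/-- ★★ **The relative links lie in the cap with small vector part**: for `0 ≤ δ ≤ 1/50`, `(U_e p_k⁻¹)₀ ≥ 0` and `|(U_e p_k⁻¹)⃗|² ≤ 10δ ≤ 1/4`. [folklore] -/
theorem sum_vecPart_rel_sq_le {U : GaugeConfig 3 L SU2} {δ : ℝ} (hδ : 0 ≤ δ) (hU : ∀ e : Edge 3 L, 1 - δ ≤ scalarPart (U e)) (hδ2 : δ ≤ 1 / 50)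
    (x : Site 3 L) (k : Fin 3) :
    0 ≤ scalarPart (U (x, k) * (polarMean L k U)⁻¹) ∧ ∑ a, vecPart (U (x, k) * (polarMean L k U)⁻¹) a ^ 2 ≤ 10 * δ := by
  have hδ1 : δ < 1 := by linarith
  have hM := dirQuat_ne_zero_of_near hU hδ1 k
  have hnpos : 0 < ‖dirQuat L k U‖ := norm_pos_iff.mpr hM
  have hge := scalarPart_rel_mul_norm_ge hδ hU hδ1 x k
  have hnsq := norm_dirQuat_sq_le hδ hU k
  set N : ℝ := (Fintype.card (Site 3 L) : ℝ) with hN_def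
  have hN : (0 : ℝ) < N := by rw [hN_def]; exact_mod_cast Fintype.card_pos
  set σ := scalarPart (U (x, k) * (polarMean L k U)⁻¹) with hσ
  have hc1 : 0 < 1 - 4 * δ + δ ^ 2 := by nlinarith
  have hσpos : 0 ≤ σ := by
    by_contra hneg
    push Not at hneg
    have : σ * ‖dirQuat L k U‖ < 0 := mul_neg_of_neg_of_pos hneg hnpos
    nlinarith [mul_pos hN hc1]
  refine ⟨hσpos, ?_⟩
  rw [sum_vecPart_sq]
  -- `σ² ‖M‖² ≥ N² c₁²` and `‖M‖² ≤ N²(1+2δ)` ⇒ `σ² (1+2δ) ≥ c₁²`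
  have h1 : (N * (1 - 4 * δ + δ ^ 2)) ^ 2 ≤ (σ * ‖dirQuat L k U‖) ^ 2 := by
    have h0 : 0 ≤ N * (1 - 4 * δ + δ ^ 2) := by positivity
    nlinarith
  have h2 : σ ^ 2 * ‖dirQuat L k U‖ ^ 2 ≤ σ ^ 2 * (N ^ 2 * (1 + 2 * δ)) := mul_le_mul_of_nonneg_left hnsq (sq_nonneg _)
  have h3 : N ^ 2 * (1 - 4 * δ + δ ^ 2) ^ 2 ≤ σ ^ 2 * (N ^ 2 * (1 + 2 * δ)) := by nlinarith
  have hN2 : 0 < N ^ 2 := by positivity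
  have h4 : (1 - 4 * δ + δ ^ 2) ^ 2 ≤ σ ^ 2 * (1 + 2 * δ) := by
    have := le_of_mul_le_mul_left (by nlinarith : N ^ 2 * (1 - 4 * δ + δ ^ 2) ^ 2 ≤ N ^ 2 * (σ ^ 2 * (1 + 2 * δ))) hN2
    exact this
  -- the polynomial endgame: `1 − c₁²/(1+2δ) ≤ 10δ`
  nlinarith [sq_nonneg δ, sq_nonneg σ]

end Near

/-! ## §3 ★★★ Membership in the orthographic tube -/

/-- ★★★ **COVERAGE near the vacuum**: if every link has `(U_e)₀ ≥ 1 − δ`, `0 ≤ δ ≤ 1/50`, then `U = orthoTube L (slowMean L U) v` with the explicit balanced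
transverse coordinate `v_e = (U_e · p_{dir e}⁻¹)⃗ ∈ capBalancedSet L`, `|v_e|² ≤ 10δ`; in particular `U ∈ orthoTubeSet L`. [folklore] -/
theorem mem_orthoTubeSet_of_near_one {U : GaugeConfig 3 L SU2} {δ : ℝ} (hδ : 0 ≤ δ) (hδ2 : δ ≤ 1 / 50)
    (hU : ∀ e : Edge 3 L, 1 - δ ≤ scalarPart (U e)) :
    orthoTube L (slowMean L U) (fun e => vecPart (U e * (polarMean L e.2 U)⁻¹)) = U ∧ U ∈ orthoTubeSet L ∧
      (fun e => vecPart (U e * (polarMean L e.2 U)⁻¹)) ∈ capBalancedSet L ∧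
      ∀ e : Edge 3 L, ∑ a, vecPart (U e * (polarMean L e.2 U)⁻¹) a ^ 2 ≤ 10 * δ := by
  have hδ1 : δ < 1 := by linarith
  have hcap := fun e : Edge 3 L => sum_vecPart_rel_sq_le hδ hU hδ2 e.1 e.2
  have h0 : ∀ e : Edge 3 L, 0 ≤ scalarPart (U e * (slowMean L U (0, e.2))⁻¹) := fun e => (hcap e).1
  have hc : ∀ e : Edge 3 L, ∑ a, vecPart (U e * (slowMean L U (0, e.2))⁻¹) a ^ 2 ≤ 1 / 4 := fun e => by
    have := (hcap e).2; simp only [slowMean_apply] ; linarith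
  have hbal : ∀ (k : Fin 3) (a : Fin 3), ∑ x : Site 3 L, vecPart (U (x, k) * (slowMean L U (0, k))⁻¹) a = 0 := fun k a => by
    simp only [slowMean_apply]
    exact sum_vecPart_mul_polarMean_inv_apply L (dirQuat_ne_zero_of_near hU hδ1 k) a
  have hm := mem_orthoTubeSet_of L U (slowMean L U) h0 hc hbal
  simp only [slowMean_apply] at hm
  refine ⟨hm.1, hm.2, ⟨fun k a => ?_, fun e => ?_⟩, fun e => (hcap e).2⟩
  · exact sum_vecPart_mul_polarMean_inv_apply L (dirQuat_ne_zero_of_near hU hδ1 k) a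
  · have := (hcap e).2; linarith

end Summit.QuantumFields.YangMills.Theorems.FemtoTransferGap.TwoLattice.ConstTube

end
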